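import Mathlib
import Literature.Combinatorics.SimpleGraph.ShortEvenClosedWalkLevels

/-!
# Short even closed walks in dense edge sets, part 2: the walk (folklore Moore bound)

Continuation of `ShortEvenClosedWalkLevels.lean` (breadth-first levels `L k`, parent choice `π`,
`level_step`, `sum_X_le`).  Here: level growth `|L R| ≥ 2^{R-1}` when at most one non-parent edge
meets the ball of radius `R - 1`; hence two such edges when `|L R|` is small; the closed walk through
the root attached to a non-parent edge (parent chains on both sides, the edge used exactly once); the
minimal-vertex-set reduction to degree `≥ 3`; and the final definition-free statement
`exists_short_even_closed_walk`: an edge set `E ⊆ Sym2 V` with `|E| ≥ 2|V|`, `|V| ≤ m`, `m ≥ 64`,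
has a closed walk of even length `L ≤ ⌊log₂ m⌋²` traversing some edge exactly once.
Folklore (irregular Moore bound: Alon–Hoory–Linial 2002; even cycles: Bondy–Simonovits 1974).
-/

namespace Literature.Combinatorics.SimpleGraph

namespace EvenClosedWalk

open Finset

variable {V : Type*} [DecidableEq V]

/-! ## Level growth and two non-parent edges near the root -/

/-- **Level growth.**  If all degrees on the levels `< R` are `≥ 3` and at most one non-parent
edge meets the ball of radius `R - 1`, then `|L R| ≥ 2^{R-1}`. [folklore] -/
theorem level_growth [Fintype V] {E : Finset (Sym2 V)} {r : V} {B L : ℕ → Finset V}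
    (hB0 : B 0 = {r}) (hBs : ∀ k, B (k + 1) = B k ∪ univ.filter fun y => ∃ x ∈ B k, s(x, y) ∈ E)
    (hL0 : L 0 = {r}) (hLs : ∀ k, L (k + 1) = B (k + 1) \ B k)
    {π : V → V} (hπ : ∀ k v, v ∈ L (k + 1) → π v ∈ L k ∧ s(π v, v) ∈ E)
    {inc : V → Sym2 V → ℕ}
    (hinc : ∀ v x y, inc v s(x, y) = (if x = v then 1 else 0) + (if y = v then 1 else 0))
    {R : ℕ} (hR : 1 ≤ R) {U : Finset V} (hU : U = (range R).biUnion fun k => L (k + 1))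
    {PE : Finset (Sym2 V)} (hPE : PE = U.image fun u => s(π u, u))
    (hdeg : ∀ i < R, ∀ v ∈ L i, 3 ≤ ∑ e ∈ E, inc v e) (NPt : Finset (Sym2 V))
    (hNPt : ∀ e, e ∈ NPt ↔ e ∈ E \ PE ∧ ∃ v ∈ B (R - 1), v ∈ e) (hNP : #NPt ≤ 1) :
    2 ^ (R - 1) ≤ #(L R) := by
  -- `X i` = non-parent incidences on level `i`; their total over `i < R` is `≤ 2`
  set X : ℕ → ℕ := fun i => ∑ v ∈ L i, ∑ e ∈ E \ PE, inc v e with hX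
  have hXtot : ∑ i ∈ range R, X i ≤ 2 :=
    (sum_X_le hB0 hBs hL0 hLs hinc hR (E \ PE) NPt hNPt).trans (by omega)
  have hXpart : ∀ i ≤ R, ∑ j ∈ range i, X j ≤ 2 := fun i hi =>
    (sum_le_sum_of_subset_of_nonneg (range_subset_range.mpr hi) fun _ _ _ => Nat.zero_le _).trans hXtot
  have h1 : 3 ≤ #(L 1) + X 0 := by
    have hr : r ∈ L 0 := by rw [hL0]; exact mem_singleton_self r
    have := level_one hB0 hBs hL0 hLs hπ hinc hU hPE (hdeg 0 (by omega) r hr)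
    simpa [hX, hL0] using this
  have hstep : ∀ i, 1 ≤ i → i + 1 ≤ R → 2 * #(L i) ≤ #(L (i + 1)) + X i := fun i hi1 hiR =>
    level_step hB0 hBs hL0 hLs hπ hinc hU hPE hi1 hiR (hdeg i (by omega))
  -- potential: `2^i (4 - Σ_{j<i} X j) ≤ 4 |L i|` for `1 ≤ i ≤ R`, over `ℤ`
  have hpot : ∀ i, 1 ≤ i → i ≤ R →
      (2 : ℤ) ^ i * (4 - ∑ j ∈ range i, (X j : ℤ)) ≤ 4 * #(L i) := by
    intro i hi1
    induction i, hi1 using Nat.le_induction with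
    | base =>
      intro _
      have hX0 : (X 0 : ℤ) ≤ 2 := by exact_mod_cast (by simpa using hXpart 1 hR)
      have h1' : (3 : ℤ) ≤ #(L 1) + X 0 := by exact_mod_cast h1
      simp only [pow_one, range_one, sum_singleton]
      linarith
    | succ i hi1 ih =>
      intro hiR
      have ih' := ih (by omega)
      have hs : (2 : ℤ) * #(L i) ≤ #(L (i + 1)) + X i := by exact_mod_cast hstep i hi1 hiR
      have hXi : (0 : ℤ) ≤ X i := by exact_mod_cast Nat.zero_le _
      have h2i : (2 : ℤ) ≤ 2 ^ i := by
        calc (2 : ℤ) = 2 ^ 1 := by norm_num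
          _ ≤ 2 ^ i := pow_le_pow_right₀ (by norm_num) hi1
      rw [sum_range_succ, pow_succ]
      nlinarith [mul_nonneg (sub_nonneg.mpr h2i) hXi]
  have hfin := hpot R hR le_rfl
  have hY : ∑ j ∈ range R, (X j : ℤ) ≤ 2 := by exact_mod_cast hXtot
  have h2R : (2 : ℤ) ^ R = 2 * 2 ^ (R - 1) := by
    rw [← pow_succ']; congr 1; omega
  have : (2 : ℤ) ^ (R - 1) ≤ #(L R) := by nlinarith [pow_pos (show (0 : ℤ) < 2 by norm_num) (R - 1)]
  exact_mod_cast this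


/-- If all degrees on the levels `< R` are `≥ 3` but `|L R| < 2^{R-1}`, two distinct non-parent
edges meet the ball of radius `R - 1`. [folklore] -/
theorem two_nonparent [Fintype V] {E : Finset (Sym2 V)} {r : V} {B L : ℕ → Finset V}
    (hB0 : B 0 = {r}) (hBs : ∀ k, B (k + 1) = B k ∪ univ.filter fun y => ∃ x ∈ B k, s(x, y) ∈ E)
    (hL0 : L 0 = {r}) (hLs : ∀ k, L (k + 1) = B (k + 1) \ B k)
    {π : V → V} (hπ : ∀ k v, v ∈ L (k + 1) → π v ∈ L k ∧ s(π v, v) ∈ E)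
    {inc : V → Sym2 V → ℕ}
    (hinc : ∀ v x y, inc v s(x, y) = (if x = v then 1 else 0) + (if y = v then 1 else 0))
    {R : ℕ} (hR : 1 ≤ R) {U : Finset V} (hU : U = (range R).biUnion fun k => L (k + 1))
    {PE : Finset (Sym2 V)} (hPE : PE = U.image fun u => s(π u, u))
    (hdeg : ∀ i < R, ∀ v ∈ L i, 3 ≤ ∑ e ∈ E, inc v e) (NPt : Finset (Sym2 V))
    (hNPt : ∀ e, e ∈ NPt ↔ e ∈ E \ PE ∧ ∃ v ∈ B (R - 1), v ∈ e) (hsmall : #(L R) < 2 ^ (R - 1)) :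
    ∃ e₁ ∈ NPt, ∃ e₂ ∈ NPt, e₁ ≠ e₂ := by
  rw [← one_lt_card]
  by_contra h
  exact absurd (level_growth hB0 hBs hL0 hLs hπ hinc hR hU hPE hdeg NPt hNPt (not_lt.mp h))
    (not_le.mpr hsmall)

/-! ## The closed walk through the root attached to a non-parent edge -/

/-- A non-parent edge `e` meeting the ball of radius `R - 1` closes up, with the two parent chains
of its endpoints, to a closed walk `ω` through the root `r` of length `ℓ ≤ 2R` whose steps are
parent edges except the single step `j₀`, which is `e`. [folklore] -/
theorem closed_walk_of_nonparent [Fintype V] {E : Finset (Sym2 V)} {r : V} {B L : ℕ → Finset V}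
    (hB0 : B 0 = {r}) (hBs : ∀ k, B (k + 1) = B k ∪ univ.filter fun y => ∃ x ∈ B k, s(x, y) ∈ E)
    (hL0 : L 0 = {r}) (hLs : ∀ k, L (k + 1) = B (k + 1) \ B k)
    {π : V → V} (hπ : ∀ k v, v ∈ L (k + 1) → π v ∈ L k ∧ s(π v, v) ∈ E)
    {R : ℕ} (hR : 1 ≤ R) {U : Finset V} (hU : U = (range R).biUnion fun k => L (k + 1))
    {PE : Finset (Sym2 V)} (hPE : PE = U.image fun u => s(π u, u))
    {e : Sym2 V} (he : e ∈ E) (hball : ∃ v ∈ B (R - 1), v ∈ e) :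
    ∃ (ℓ : ℕ) (ω : ℕ → V) (j₀ : ℕ), ℓ ≤ 2 * R ∧ j₀ < ℓ ∧ ω 0 = r ∧ ω ℓ = r ∧
      (∀ s < ℓ, s(ω s, ω (s + 1)) ∈ E) ∧ (∀ s < ℓ, s ≠ j₀ → s(ω s, ω (s + 1)) ∈ PE) ∧
      s(ω j₀, ω (j₀ + 1)) = e := by
  obtain ⟨x, hxB, hxe⟩ := hball
  -- endpoints `x ∈ L j` (`j ≤ R - 1`) and `y ∈ L j'` (`j' ≤ R`)
  set y : V := Sym2.Mem.other hxe with hy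
  have hexy : s(x, y) = e := Sym2.other_spec hxe
  obtain ⟨j, hjR, hxj⟩ := (mem_B_iff hB0 hBs hL0 hLs).mp hxB
  have hyB : y ∈ B (j + 1) := mem_B_succ_of_edge hBs (L_subset_B hB0 hL0 hLs j hxj) (hexy ▸ he)
  obtain ⟨j', hj'R, hyj'⟩ := (mem_B_iff hB0 hBs hL0 hLs).mp hyB
  -- parent edges of chain vertices are in `PE`
  have hPEmem : ∀ (k : ℕ) (u : V), u ∈ L k → 1 ≤ k → k ≤ R → s(π u, u) ∈ PE := by
    intro k u hu hk1 hkR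
    rw [hPE, mem_image]
    refine ⟨u, ?_, rfl⟩
    rw [hU, mem_biUnion]
    refine ⟨k - 1, mem_range.mpr (by omega), ?_⟩
    rwa [Nat.sub_add_cancel hk1]
  have hPEE : PE ⊆ E := PE_subset hπ hU hPE
  -- the walk: down the chain of `x` (reversed), across `e`, up the chain of `y`
  refine ⟨j + 1 + j', fun s => if s ≤ j then π^[j - s] x else π^[s - (j + 1)] y, j,
    by omega, by omega, ?_, ?_, ?_, ?_, ?_⟩
  · simp only [Nat.zero_le, if_true, Nat.sub_zero]
    exact iterate_eq_root hL0 hπ hxj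
  · have h : ¬ j + 1 + j' ≤ j := by omega
    simp only [h, if_false, show j + 1 + j' - (j + 1) = j' by omega]
    exact iterate_eq_root hL0 hπ hyj'
  · -- every step is an edge
    intro s hs
    rcases Nat.lt_trichotomy s j with hsj | rfl | hjs
    · have h1 : s ≤ j := hsj.le
      have h2 : s + 1 ≤ j := hsj
      simp only [h1, h2, if_true]
      have hu := iterate_mem hπ hxj (show j - (s + 1) ≤ j by omega)
      rw [show j - (j - (s + 1)) = s + 1 by omega] at hu
      rw [show j - s = (j - (s + 1)) + 1 by omega, Function.iterate_succ_apply']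
      exact hPEE (hPEmem (s + 1) _ hu (by omega) (by omega))
    · have h2 : ¬ s + 1 ≤ s := by omega
      simp only [le_rfl, if_true, h2, if_false, Nat.sub_self, Function.iterate_zero, id_eq, hexy]
      exact he
    · have h1 : ¬ s ≤ j := by omega
      have h2 : ¬ s + 1 ≤ j := by omega
      simp only [h1, h2, if_false]
      have hu := iterate_mem hπ hyj' (show s - (j + 1) ≤ j' by omega)
      rw [show s + 1 - (j + 1) = (s - (j + 1)) + 1 by omega, Function.iterate_succ_apply', Sym2.eq_swap]
      exact hPEE (hPEmem (j' - (s - (j + 1))) _ hu (by omega) (by omega))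
  · -- every step other than `j₀ = j` is a parent edge
    intro s hs hsj0
    rcases Nat.lt_trichotomy s j with hsj | rfl | hjs
    · have h1 : s ≤ j := hsj.le
      have h2 : s + 1 ≤ j := hsj
      simp only [h1, h2, if_true]
      have hu := iterate_mem hπ hxj (show j - (s + 1) ≤ j by omega)
      rw [show j - (j - (s + 1)) = s + 1 by omega] at hu
      rw [show j - s = (j - (s + 1)) + 1 by omega, Function.iterate_succ_apply']
      exact hPEmem (s + 1) _ hu (by omega) (by omega)
    · exact (hsj0 rfl).elim
    · have h1 : ¬ s ≤ j := by omega
      have h2 : ¬ s + 1 ≤ j := by omega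
      simp only [h1, h2, if_false]
      have hu := iterate_mem hπ hyj' (show s - (j + 1) ≤ j' by omega)
      rw [show s + 1 - (j + 1) = (s - (j + 1)) + 1 by omega, Function.iterate_succ_apply', Sym2.eq_swap]
      exact hPEmem (j' - (s - (j + 1))) _ hu (by omega) (by omega)
  · have h2 : ¬ j + 1 ≤ j := by omega
    simp only [le_rfl, if_true, h2, if_false, Nat.sub_self, Function.iterate_zero, id_eq, hexy]

/-! ## Minimal vertex sets have all degrees at least three -/

/-- If `S` is a nonempty vertex set of minimal size with `|E[S]| ≥ 2|S|` (`E[S]` = edges of `E`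
inside `S`), then every vertex of `S` has `E[S]`-degree `≥ 3` (loops counted twice). [folklore] -/
theorem three_le_deg_of_minimal {inc : V → Sym2 V → ℕ}
    (hinc : ∀ v x y, inc v s(x, y) = (if x = v then 1 else 0) + (if y = v then 1 else 0))
    (E : Finset (Sym2 V)) (ES : Finset V → Finset (Sym2 V))
    (hES : ∀ S e, e ∈ ES S ↔ e ∈ E ∧ ∀ w ∈ e, w ∈ S) (S : Finset V)
    (hS : 2 * #S ≤ #(ES S))
    (hmin : ∀ S' : Finset V, S'.Nonempty → 2 * #S' ≤ #(ES S') → #S ≤ #S') :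
    ∀ v ∈ S, 3 ≤ ∑ e ∈ ES S, inc v e := by
  intro v hv
  by_contra hlt
  push Not at hlt
  have hdeg : #((ES S).filter fun e => v ∈ e) ≤ 2 :=
    (card_filter_mem_le_deg hinc (ES S) v).trans (by omega)
  -- `S` has at least two elements: a single vertex carries at most one edge (its loop)
  have hcard : 2 ≤ #S := by
    by_contra h1
    have hS1 : S = {v} := by
      apply eq_singleton_iff_unique_mem.mpr ⟨hv, fun w hw => ?_⟩
      by_contra hne
      have : 2 ≤ #S := by
        rw [← card_pair hne]
        exact card_le_card (by simp [insert_subset_iff, hw, hv])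
      exact h1 this
    have hsub : ES S ⊆ {s(v, v)} := by
      intro e he
      rw [mem_singleton]
      have hw := ((hES S e).mp he).2
      induction e using Sym2.ind with
      | _ a b =>
        have ha : a = v := by simpa [hS1] using hw a (Sym2.mem_mk_left a b)
        have hb : b = v := by simpa [hS1] using hw b (Sym2.mem_mk_right a b)
        rw [ha, hb]
    have h1 := card_le_card hsub
    rw [card_singleton] at h1
    have h2 : #S = 1 := by rw [hS1, card_singleton]
    omega
  -- delete `v`
  set S' := S.erase v with hS'
  have hS'card : #S' + 1 = #S := card_erase_add_one hv
  have hS'ne : S'.Nonempty := by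
    rw [← card_pos]; omega
  have hsub : (ES S).filter (fun e => v ∉ e) ⊆ ES S' := by
    intro e he
    rw [mem_filter] at he
    obtain ⟨he, hve⟩ := he
    rw [hES] at he ⊢
    exact ⟨he.1, fun w hw => mem_erase.mpr ⟨fun h => hve (h ▸ hw), he.2 w hw⟩⟩
  have hsplit := card_filter_add_card_filter_not (s := ES S) (fun e => v ∈ e)
  have h2 : 2 * #S' ≤ #(ES S') := by
    have := card_le_card hsub
    omega
  have := hmin S' hS'ne h2
  omega

end EvenClosedWalk

open Finset

/-! ## The girth lemma -/

/-- **Short even closed walks.**  If `E ⊆ Sym2 V` has at least `2 |V|` edges (loops allowed),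
`|V| ≤ m` and `m ≥ 64`, there is a closed walk `ω 0, ω 1, …, ω L = ω 0` along edges of `E`, of
EVEN length `L ≤ ⌊log₂ m⌋²`, in which the edge of some step `s₀` is traversed exactly once.  Its
alternating edge sum `Σ_s (-1)^s [edge_s]` is then a nonzero integer vector of `ℓ¹`-norm `≤ L` in
the kernel of the unsigned incidence matrix of `E`. [folklore] -/
theorem exists_short_even_closed_walk {V : Type*} [Fintype V] [DecidableEq V] [Nonempty V]
    (E : Finset (Sym2 V)) {m : ℕ} (hm : 64 ≤ m) (hV : Fintype.card V ≤ m)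
    (hE : 2 * Fintype.card V ≤ #E) :
    ∃ (L : ℕ) (ω : ℕ → V) (s₀ : ℕ), L ≤ Nat.log 2 m ^ 2 ∧ Even L ∧ s₀ < L ∧ ω L = ω 0 ∧
      (∀ s < L, s(ω s, ω (s + 1)) ∈ E) ∧
      ∀ s < L, s(ω s, ω (s + 1)) = s(ω s₀, ω (s₀ + 1)) → s = s₀ := by
  classical
  -- incidence numbers
  let inc : V → Sym2 V → ℕ := fun v =>
    Sym2.lift ⟨fun x y => (if x = v then 1 else 0) + (if y = v then 1 else 0), fun _ _ => add_comm _ _⟩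
  have hinc : ∀ v x y, inc v s(x, y) = (if x = v then 1 else 0) + (if y = v then 1 else 0) :=
    fun v x y => rfl
  -- a minimal vertex set `S` with `|E[S]| ≥ 2 |S|`
  let ES : Finset V → Finset (Sym2 V) := fun S => E.filter fun e => ∀ w ∈ e, w ∈ S
  have hES : ∀ S e, e ∈ ES S ↔ e ∈ E ∧ ∀ w ∈ e, w ∈ S := fun S e => by simp [ES]
  let fam : Finset (Finset V) := univ.powerset.filter fun S => S.Nonempty ∧ 2 * #S ≤ #(ES S)
  have huniv : (univ : Finset V) ∈ fam := by
    refine mem_filter.mpr ⟨mem_powerset.mpr Subset.rfl, univ_nonempty, ?_⟩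
    have : ES univ = E := by ext e; simp [ES]
    rw [this, card_univ]; exact hE
  obtain ⟨S, hSfam, hSmin⟩ := exists_min_image fam card ⟨univ, huniv⟩
  obtain ⟨-, hSne, hS2⟩ := mem_filter.mp hSfam
  have hmin : ∀ S' : Finset V, S'.Nonempty → 2 * #S' ≤ #(ES S') → #S ≤ #S' := fun S' h1 h2 =>
    hSmin S' (mem_filter.mpr ⟨mem_powerset.mpr (subset_univ _), h1, h2⟩)
  have hdeg3 := EvenClosedWalk.three_le_deg_of_minimal hinc E ES hES S hS2 hmin
  -- breadth-first data inside `S` for the edge set `E[S]`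
  obtain ⟨r, hr⟩ := hSne
  let F : Finset (Sym2 V) := ES S
  let B : ℕ → Finset V := fun k =>
    Nat.rec {r} (fun _ Bk => Bk ∪ univ.filter fun y => ∃ x ∈ Bk, s(x, y) ∈ F) k
  have hB0 : B 0 = {r} := rfl
  have hBs : ∀ k, B (k + 1) = B k ∪ univ.filter fun y => ∃ x ∈ B k, s(x, y) ∈ F := fun k => rfl
  let Lv : ℕ → Finset V := fun k => if k = 0 then {r} else B k \ B (k - 1)
  have hL0 : Lv 0 = {r} := by simp [Lv]
  have hLs : ∀ k, Lv (k + 1) = B (k + 1) \ B k := fun k => by simp [Lv]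
  -- parent choice
  have hex : ∀ k v, v ∈ Lv (k + 1) → ∃ x ∈ Lv k, s(x, v) ∈ F := fun k v hv =>
    EvenClosedWalk.exists_parent hB0 hBs hL0 hLs hv
  let π : V → V := fun v =>
    if h : ∃ p : ℕ × V, v ∈ Lv (p.1 + 1) ∧ p.2 ∈ Lv p.1 ∧ s(p.2, v) ∈ F then (Classical.choose h).2
    else v
  have hπ : ∀ k v, v ∈ Lv (k + 1) → π v ∈ Lv k ∧ s(π v, v) ∈ F := by
    intro k v hv
    have h : ∃ p : ℕ × V, v ∈ Lv (p.1 + 1) ∧ p.2 ∈ Lv p.1 ∧ s(p.2, v) ∈ F := by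
      obtain ⟨x, hx, hxe⟩ := hex k v hv
      exact ⟨(k, x), hv, hx, hxe⟩
    have hspec := Classical.choose_spec h
    have hk : (Classical.choose h).1 = k := by
      have := EvenClosedWalk.L_eq_of_mem hB0 hBs hL0 hLs hspec.1 hv
      omega
    simp only [π, dif_pos h]
    rw [← hk]
    exact ⟨hspec.2.1, hspec.2.2⟩
  -- radius, levels `1 … R`, parent edges, non-parent edges meeting the ball
  set R : ℕ := Nat.log 2 m + 2 with hRdef
  have hR : 1 ≤ R := by omega
  let U : Finset V := (range R).biUnion fun k => Lv (k + 1)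
  let PE : Finset (Sym2 V) := U.image fun u => s(π u, u)
  let NPt : Finset (Sym2 V) := (F \ PE).filter fun e => ∃ v ∈ B (R - 1), v ∈ e
  have hNPt : ∀ e, e ∈ NPt ↔ e ∈ F \ PE ∧ ∃ v ∈ B (R - 1), v ∈ e := fun e => by
    simp only [NPt, mem_filter]
  -- balls stay inside `S`, so `|L R| ≤ |S| ≤ |V| ≤ m < 2^{R-1}`
  have hBS : ∀ k, B k ⊆ S := by
    intro k
    induction k with
    | zero => rw [hB0]; exact singleton_subset_iff.mpr hr
    | succ k ih =>
      rw [hBs]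
      refine union_subset ih fun y hy => ?_
      obtain ⟨-, x, -, hxy⟩ := mem_filter.mp hy
      exact ((hES S _).mp hxy).2 y (Sym2.mem_mk_right x y)
  have hsmall : #(Lv R) < 2 ^ (R - 1) := by
    calc #(Lv R) ≤ #S := card_le_card ((EvenClosedWalk.L_subset_B hB0 hL0 hLs R).trans (hBS R))
      _ ≤ Fintype.card V := card_le_univ S
      _ ≤ m := hV
      _ < 2 ^ (Nat.log 2 m).succ := Nat.lt_pow_succ_log_self (by norm_num) m
      _ = 2 ^ (R - 1) := by rw [hRdef]; rfl
  have hdegL : ∀ i < R, ∀ v ∈ Lv i, 3 ≤ ∑ e ∈ F, inc v e := fun i _ v hv =>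
    hdeg3 v (hBS i (EvenClosedWalk.L_subset_B hB0 hL0 hLs i hv))
  -- two distinct non-parent edges meeting the ball, and their closed walks
  obtain ⟨e₁, he₁, e₂, he₂, hne⟩ := EvenClosedWalk.two_nonparent hB0 hBs hL0 hLs hπ hinc hR rfl rfl hdegL
    NPt hNPt hsmall
  obtain ⟨he₁F, hball₁⟩ := (hNPt e₁).mp he₁
  obtain ⟨he₂F, hball₂⟩ := (hNPt e₂).mp he₂
  have he₁PE : e₁ ∉ PE := (mem_sdiff.mp he₁F).2
  have he₂PE : e₂ ∉ PE := (mem_sdiff.mp he₂F).2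
  obtain ⟨ℓ₁, ω₁, j₁, hℓ₁, hj₁, h0₁, hend₁, hE₁, hP₁, hedge₁⟩ :=
    EvenClosedWalk.closed_walk_of_nonparent hB0 hBs hL0 hLs hπ hR rfl rfl (mem_sdiff.mp he₁F).1 hball₁
  obtain ⟨ℓ₂, ω₂, j₂, hℓ₂, hj₂, h0₂, hend₂, hE₂, hP₂, hedge₂⟩ :=
    EvenClosedWalk.closed_walk_of_nonparent hB0 hBs hL0 hLs hπ hR rfl rfl (mem_sdiff.mp he₂F).1 hball₂
  have hFE : F ⊆ E := filter_subset _ _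
  -- length bookkeeping: `4 R ≤ ⌊log₂ m⌋²` for `m ≥ 64`
  have hlog : 6 ≤ Nat.log 2 m := Nat.le_log_of_pow_le (by norm_num) (by simpa using hm)
  have hlen : 4 * R ≤ Nat.log 2 m ^ 2 := by rw [hRdef]; nlinarith
  -- once-traversed edge in a single walk
  have honce₁ : ∀ s < ℓ₁, s(ω₁ s, ω₁ (s + 1)) = e₁ → s = j₁ := fun s hs h => by
    by_contra hsj; exact he₁PE (h ▸ hP₁ s hs hsj)
  have honce₂ : ∀ s < ℓ₂, s(ω₂ s, ω₂ (s + 1)) = e₂ → s = j₂ := fun s hs h => by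
    by_contra hsj; exact he₂PE (h ▸ hP₂ s hs hsj)
  rcases Nat.even_or_odd ℓ₁ with hev₁ | hodd₁
  · refine ⟨ℓ₁, ω₁, j₁, by omega, hev₁, hj₁, by rw [hend₁, h0₁], fun s hs => hFE (hE₁ s hs), ?_⟩
    intro s hs h
    rw [hedge₁] at h
    exact honce₁ s hs h
  rcases Nat.even_or_odd ℓ₂ with hev₂ | hodd₂
  · refine ⟨ℓ₂, ω₂, j₂, by omega, hev₂, hj₂, by rw [hend₂, h0₂], fun s hs => hFE (hE₂ s hs), ?_⟩
    intro s hs h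
    rw [hedge₂] at h
    exact honce₂ s hs h
  -- both odd: concatenate at the root
  refine ⟨ℓ₁ + ℓ₂, fun s => if s ≤ ℓ₁ then ω₁ s else ω₂ (s - ℓ₁), j₁, by omega,
    Odd.add_odd hodd₁ hodd₂, by omega, ?_, ?_, ?_⟩
  · have h : ¬ ℓ₁ + ℓ₂ ≤ ℓ₁ := by omega
    simp only [h, if_false, Nat.zero_le, if_true, Nat.add_sub_cancel_left, hend₂, h0₁]
  · intro s hs
    by_cases h1 : s + 1 ≤ ℓ₁
    · have h0 : s ≤ ℓ₁ := by omega
      simp only [h0, h1, if_true]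
      exact hFE (hE₁ s (by omega))
    · by_cases h0 : s ≤ ℓ₁
      · obtain hs1 : ℓ₁ = s := by omega
        subst hs1
        simp only [le_rfl, if_true, h1, if_false, hend₁, ← h0₂, show ℓ₁ + 1 - ℓ₁ = 0 + 1 by omega]
        exact hFE (hE₂ 0 (by omega))
      · simp only [h0, h1, if_false, show s + 1 - ℓ₁ = (s - ℓ₁) + 1 by omega]
        exact hFE (hE₂ (s - ℓ₁) (by omega))
  · intro s hs h
    have hj1' : j₁ + 1 ≤ ℓ₁ := hj₁
    simp only [hj₁.le, hj1', if_true, hedge₁] at h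
    by_cases h1 : s + 1 ≤ ℓ₁
    · have h0 : s ≤ ℓ₁ := by omega
      simp only [h0, h1, if_true] at h
      exact honce₁ s (by omega) h
    · exfalso
      by_cases h0 : s ≤ ℓ₁
      · obtain hs1 : ℓ₁ = s := by omega
        subst hs1
        simp only [le_rfl, if_true, h1, if_false, hend₁, ← h0₂, show ℓ₁ + 1 - ℓ₁ = 0 + 1 by omega] at h
        -- step `0` of `ω₂` is a parent edge or `e₂`, neither is `e₁`
        by_cases hj20 : (0 : ℕ) = j₂
        · exact hne (h.symm.trans (hj20 ▸ hedge₂))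
        · exact he₁PE (h ▸ hP₂ 0 (by omega) hj20)
      · simp only [h0, h1, if_false, show s + 1 - ℓ₁ = (s - ℓ₁) + 1 by omega] at h
        by_cases hj2 : s - ℓ₁ = j₂
        · exact hne (h.symm.trans (hj2 ▸ hedge₂))
        · exact he₁PE (h ▸ hP₂ (s - ℓ₁) (by omega) hj2)

end Literature.Combinatorics.SimpleGraph
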